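import Summits.PneNP.PneNP.Theorems.NegLimitedGapPMMinterms
import Summits.PneNP.PneNP.Theorems.NegLimitedDeficientMass

/-!
# Route NegLimited — the gap perfect-matching lower bound, parametric form (rung F-N1/p3, line r7-crosscut, file C4)

The analogue of CKR Thm. 2.19 (tree: `CKR.harnikRaz_size_mul_ge`, `HarnikRazLowerBound.lean`) for the
PROMISE problem `GapPM_K` (accept every graph with a perfect matching, reject every `K`-deficient
graph), cell record HOME/pnp-ideate-p3/ROUND-7.md §4 ("FINAL INEQUALITY"): run the approximation
method (`exists_approxW`) with the `μ`-closure scheme for `μ = crossMeasure (1/8)` (law of the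
`1/8`-biased cross-cut graph), positive test inputs the uniform perfect matchings. Since every perfect
matching is accepted, and the cross-cut graphs with `2|W| ≤ m` (mass `≥ 1/2`, `DeficientMass`) are
`K`-deficient (`CrossDeficient`) hence rejected, one gets (`gapPM_dichotomy`): EITHER the output
approximator is `≡ 1` and `1/2 ≤ size · ε · #{A : |A| ≤ c}`, OR it is not and
`1 - S ≤ size · δP` with `S = ∑_{1 ≤ ℓ ≤ c/2} thr(ℓ)(m-ℓ)!/m!`, `δP = ∑_{c/2 < ℓ ≤ c} thr(ℓ)(m-ℓ)!/m!`,
`thr(ℓ) = (64 c₀ ℓ log²(ℓ/ε))^ℓ` the biased-sunflower threshold at `p = 1/8`. This file also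
DECLARES `Deficient`, `CrossDeficient` (verbatim from HOME/pnp-ideate-p3/turnkey-R8/NegLimitedGapPMDefs.lean,
shared namespace) with p3's proof `crossDeficient_holds`. The parameter discharge (`w = ⌊m^{1/3-δ/2}⌋`, `c = 2w`, `ε = m^{-5w}`) is in `NegLimitedGapPMExp.lean`.
-/

set_option linter.dupNamespace false -- `Summit.PneNP.PneNP.…`: summit = sub-problem name (D-0017 single-conjunct layout)

namespace Summit.PneNP.PneNP.Theorems.NegLimitedGapPM

open Finset Literature.Computability.Complexity Literature.Computability.Complexity.Razborov
  Literature.Computability.Complexity.CKR Literature.Computability.Complexity.PerfectMatching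
open Literature.Combinatorics.SetFamily (finsetEquivFun biasedWeight biasedWeight_nonneg
  sum_biasedWeight)
open Literature.Barriers.PneNP (perfectMatchingFn perfectMatchingFn_permInput)

variable {m : ℕ}

/-! ### Deficiency (statements verbatim from the skeleton line `r7-crosscut`; R7-C1 proved by p3) -/

/-- `K`-deficiency, spelled exactly as in the route item. -/
def Deficient (m K : ℕ) (b : Edge m → Bool) : Prop :=
  ∀ D : Finset (Edge m), IsMatching D → (∀ e ∈ D, b e = true) → D.card + m / K ≤ m

/-- R7-C1: small cross-cut graphs are deficient. -/
def CrossDeficient : Prop :=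
  ∀ (m K : ℕ) (W : Finset (Vtx m)), 2 ≤ K → 2 * #W ≤ m → Deficient m K (crossInput W)

/-- R7-C1 PROVED: a matching inside `crossGraph W` injects into `W` via its `W`-endpoint. -/
theorem crossDeficient_holds : CrossDeficient := by
  classical
  intro m K W hK hW D hD hDW
  have hcard : D.card ≤ #W := by
    refine Finset.card_le_card_of_injOn
      (fun e : Edge m => if Sum.inl e.1 ∈ W then (Sum.inl e.1 : Vtx m) else Sum.inr e.2) ?_ ?_
    · intro e he
      have h := hDW e he
      simp only [crossInput, crossGraph, decide_eq_true_eq, Finset.mem_filter, Finset.mem_univ,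
        true_and] at h
      show (if Sum.inl e.1 ∈ W then (Sum.inl e.1 : Vtx m) else Sum.inr e.2) ∈ (W : Set (Vtx m))
      rw [Finset.mem_coe]
      split_ifs with h1
      · exact h1
      · by_contra h2
        exact h (iff_of_false h1 h2)
    · intro e₁ he₁ e₂ he₂ hfe
      have hfe' : (if Sum.inl e₁.1 ∈ W then (Sum.inl e₁.1 : Vtx m) else Sum.inr e₁.2)
          = (if Sum.inl e₂.1 ∈ W then (Sum.inl e₂.1 : Vtx m) else Sum.inr e₂.2) := hfe
      by_cases h1 : Sum.inl e₁.1 ∈ W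
      · by_cases h2 : Sum.inl e₂.1 ∈ W
        · rw [if_pos h1, if_pos h2] at hfe'
          exact hD.1 e₁ he₁ e₂ he₂ (Sum.inl.inj hfe')
        · rw [if_pos h1, if_neg h2] at hfe'
          exact absurd hfe' Sum.inl_ne_inr
      · by_cases h2 : Sum.inl e₂.1 ∈ W
        · rw [if_neg h1, if_pos h2] at hfe'
          exact absurd hfe' Sum.inr_ne_inl
        · rw [if_neg h1, if_neg h2] at hfe'
          exact hD.2 e₁ he₁ e₂ he₂ (Sum.inr.inj hfe')
  have h1 : #W ≤ m / 2 := by omega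
  have h2 : m / K ≤ m / 2 := Nat.div_le_div_left hK (by norm_num)
  omega

/-! ### The parametric dichotomy -/

/-- The positive weight an approximator `≢ 1` can carry: `S = ∑_{1 ≤ ℓ ≤ c/2} thr(ℓ)·(m-ℓ)!/m!`. -/
noncomputable def posSmall (c₀ ε : ℝ) (m c : ℕ) : ℝ :=
  ∑ ℓ ∈ Icc 1 (c / 2), thr c₀ (1 / 8) ε ℓ * (((m - ℓ).factorial : ℝ) / m.factorial)

/-- The positive per-gate loss: `δP = ∑_{c/2 < ℓ ≤ c} thr(ℓ)·(m-ℓ)!/m!`. -/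
noncomputable def posLost (c₀ ε : ℝ) (m c : ℕ) : ℝ :=
  ∑ ℓ ∈ Ioc (c / 2) c, thr c₀ (1 / 8) ε ℓ * (((m - ℓ).factorial : ℝ) / m.factorial)

/-- The negative per-gate gain: `δN = ε · #{A ⊆ Edge m : |A| ≤ c}`. -/
noncomputable def negGain (ε : ℝ) (m c : ℕ) : ℝ :=
  ε * #(univ.filter fun A : Finset (Edge m) => #A ≤ c)

/-- The input of the cross-cut graph, by support. -/
theorem finsetEquivFun_crossGraph (W : Finset (Vtx m)) :
    finsetEquivFun (crossGraph W) = crossInput W := rfl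

/-- **The gap perfect-matching dichotomy (CKR Thm. 2.19 for `GapPM_K`, parametric).** For `m ≥ 1`,
`K ≥ 2`, `c ≥ 2`, `0 < ε ≤ 1/2`, a sunflower constant `c₀ ≥ 0` with `SunflowerBound c₀`, and the
inputs `CrossDeficient`, `DeficientMass` of the line: every monotone circuit accepting all graphs with
a perfect matching and rejecting all `K`-deficient graphs satisfies
`1/2 ≤ size · δN` or `1 - S ≤ size · δP`. -/
theorem gapPM_dichotomy {c₀ : ℝ} (hSF : SunflowerBound c₀) (hc0 : 0 ≤ c₀) (hCD : CrossDeficient)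
    (hDM : DeficientMass) {K c : ℕ} (hm : 1 ≤ m) (hK : 2 ≤ K) (hc : 2 ≤ c) {ε : ℝ} (hε0 : 0 < ε)
    (hε1 : ε ≤ 1 / 2) (C : Circuit (Edge m)) (hC : C.IsOver monotoneBasis)
    (hacc : ∀ x, perfectMatchingFn m x = true → C.eval x = true)
    (hrej : ∀ x, (∀ D : Finset (Edge m), IsMatching D → (∀ e ∈ D, x e = true) → D.card + m / K ≤ m) →
      C.eval x = false) :
    1 / 2 ≤ C.size * negGain ε m c ∨ 1 - posSmall c₀ ε m c ≤ C.size * posLost c₀ ε m c := by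
  classical
  set μ : Finset (Edge m) → ℝ := crossMeasure (1 / 8) with hμdef
  have hμ0 : ∀ U, 0 ≤ μ U := fun U => crossMeasure_nonneg (by norm_num) (by norm_num) U
  have hμ1 : ∑ U, μ U = 1 := sum_crossMeasure (1 / 8)
  have hinp : ∀ e : Edge m, prW μ (fun U : Finset (Edge m) => e ∈ U) ≤ 1 - ε := fun e =>
    (prW_crossMeasure_mem_le (m := m) (by norm_num) (by norm_num) e).trans (by linarith)
  set S := schemeW μ c ε hμ0 hc hinp with hS
  set ptP : Equiv.Perm (Fin m) → Edge m → Bool := fun σ => finsetEquivFun (permGraph σ) with hptP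
  set wP : Equiv.Perm (Fin m) → ℝ := fun _ => 1 / m.factorial with hwP
  have hwP0 : ∀ σ, 0 ≤ wP σ := fun _ => by positivity
  have hmf : (0 : ℝ) < m.factorial := by exact_mod_cast Nat.factorial_pos m
  -- per-gate positive errors
  have hlost : ∀ 𝒜 ℬ, IsApproxW μ c ε 𝒜 → IsApproxW μ c ε ℬ →
      ∑ s ∈ S.lostSup univ ptP 𝒜 ℬ, wP s ≤ posLost c₀ ε m c ∧
      ∑ s ∈ S.lostInf univ ptP 𝒜 ℬ, wP s ≤ posLost c₀ ε m c := by
    intro 𝒜 ℬ h𝒜 hℬ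
    obtain ⟨hU, hI⟩ := h𝒜.card_le_of_mem_minimals_union_inter hℬ
    constructor
    · refine le_trans ?_ (sum_perm_lost_le (m := m) hSF hc0 (by norm_num) (by norm_num) hε0 hε1 hU)
      refine sum_le_sum_of_subset_of_nonneg (fun σ hσ => ?_) fun _ _ _ => by positivity
      obtain ⟨-, h⟩ := mem_filter.1 hσ
      simp only [hS, hptP, schemeW_val_finsetEquivFun, Bool.or_eq_true, decide_eq_true_eq,
        decide_eq_false_iff_not] at h
      refine mem_filter.2 ⟨mem_univ _, ?_, h.2⟩
      rcases h.1 with h' | h'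
      · exact mem_union_left _ h'
      · exact mem_union_right _ h'
    · refine le_trans ?_ (sum_perm_lost_le (m := m) hSF hc0 (by norm_num) (by norm_num) hε0 hε1 hI)
      refine sum_le_sum_of_subset_of_nonneg (fun σ hσ => ?_) fun _ _ _ => by positivity
      obtain ⟨-, h⟩ := mem_filter.1 hσ
      simp only [hS, hptP, schemeW_val_finsetEquivFun, Bool.and_eq_true, decide_eq_true_eq,
        decide_eq_false_iff_not] at h
      exact mem_filter.2 ⟨mem_univ _, mem_inter.2 h.1, h.2⟩
  -- the approximation method
  obtain ⟨𝒜, BadP, BadN, hok, hcP, hcN, hpos, hneg⟩ :=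
    exists_approxW hμ0 hμ1 hc hinp hε0.le univ ptP wP hwP0 (posLost c₀ ε m c)
      (fun a b ha hb => (hlost a b ha hb).1) (fun a b ha hb => (hlost a b ha hb).2) C hC
  -- positive accounting: every perfect matching is accepted
  have hP : (1 : ℝ) ≤ C.size * posLost c₀ ε m c +
      ∑ _σ ∈ univ.filter (fun σ : Equiv.Perm (Fin m) => permGraph σ ∈ 𝒜), (1 / m.factorial : ℝ) := by
    have hall : ∀ σ : Equiv.Perm (Fin m), C.eval (ptP σ) = true := fun σ => by
      apply hacc
      rw [hptP]
      show perfectMatchingFn m (finsetEquivFun (permGraph σ)) = true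
      rw [finsetEquivFun_permGraph]
      exact perfectMatchingFn_permInput σ
    have hsub : (univ : Finset (Equiv.Perm (Fin m))) ⊆
        BadP ∪ univ.filter fun σ : Equiv.Perm (Fin m) => permGraph σ ∈ 𝒜 := by
      intro σ _
      by_cases hB : σ ∈ BadP
      · exact mem_union_left _ hB
      · refine mem_union_right _ (mem_filter.2 ⟨mem_univ _, ?_⟩)
        have := hpos σ (mem_univ _) hB (hall σ)
        simpa [hptP] using this
    have htot : ∑ _σ : Equiv.Perm (Fin m), (1 / m.factorial : ℝ) = 1 := by
      rw [sum_const, card_univ, Fintype.card_perm, Fintype.card_fin, nsmul_eq_mul]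
      field_simp
    calc (1 : ℝ) = ∑ _σ : Equiv.Perm (Fin m), (1 / m.factorial : ℝ) := htot.symm
      _ ≤ ∑ _σ ∈ BadP ∪ univ.filter (fun σ : Equiv.Perm (Fin m) => permGraph σ ∈ 𝒜),
            (1 / m.factorial : ℝ) :=
          sum_le_sum_of_subset_of_nonneg hsub fun _ _ _ => by positivity
      _ ≤ ∑ _σ ∈ BadP, (1 / m.factorial : ℝ) +
            ∑ _σ ∈ univ.filter (fun σ : Equiv.Perm (Fin m) => permGraph σ ∈ 𝒜),
              (1 / m.factorial : ℝ) :=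
          ApproxScheme.sum_union_le_of_nonneg (fun _ => by positivity) _ _
      _ ≤ _ := by exact add_le_add hcP le_rfl
  -- negative accounting: the deficient cross-cut graphs are rejected
  have hN : (1 / 2 : ℝ) ≤ C.size * negGain ε m c + prW μ (fun U : Finset (Edge m) => U ∉ 𝒜) := by
    have hrejW : ∀ W : Finset (Vtx m), 2 * #W ≤ m → C.eval (finsetEquivFun (crossGraph W)) = false := by
      intro W hW
      apply hrej
      intro D hD hDx
      exact hCD m K W hK hW D hD fun e he => by simpa [finsetEquivFun_crossGraph] using hDx e he
    have hsub : (univ.filter fun W : Finset (Vtx m) => 2 * #W ≤ m) ⊆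
        (univ.filter fun W : Finset (Vtx m) => crossGraph W ∈ BadN) ∪
          univ.filter fun W : Finset (Vtx m) => crossGraph W ∉ 𝒜 := by
      intro W hW
      have hW := (mem_filter.1 hW).2
      rw [mem_union, mem_filter, mem_filter]
      by_cases hB : crossGraph W ∈ BadN
      · exact Or.inl ⟨mem_univ _, hB⟩
      · refine Or.inr ⟨mem_univ _, fun h𝒜 => ?_⟩
        have := hneg (crossGraph W) hB h𝒜
        rw [hrejW W hW] at this
        exact Bool.false_ne_true this
    have h18 : (0 : ℝ) ≤ 1 / 8 := by norm_num
    have h18' : (1 : ℝ) / 8 ≤ 1 := by norm_num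
    have hBadN : ∑ W ∈ univ.filter (fun W : Finset (Vtx m) => crossGraph W ∈ BadN),
        biasedWeight (1 / 8) W = ∑ U ∈ BadN, μ U := by
      rw [← prW_crossMeasure (1 / 8) (fun U => U ∈ BadN)]
      unfold prW
      rw [filter_mem_eq_inter, univ_inter]
    have hnot𝒜 : ∑ W ∈ univ.filter (fun W : Finset (Vtx m) => crossGraph W ∉ 𝒜),
        biasedWeight (1 / 8) W = prW μ (fun U : Finset (Edge m) => U ∉ 𝒜) :=
      (prW_crossMeasure (1 / 8) (fun U => U ∉ 𝒜)).symm
    calc (1 / 2 : ℝ) ≤ ∑ W ∈ univ.filter (fun W : Finset (Vtx m) => 2 * #W ≤ m),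
          biasedWeight (1 / 8) W := hDM m hm
      _ ≤ ∑ W ∈ (univ.filter fun W : Finset (Vtx m) => crossGraph W ∈ BadN) ∪
            univ.filter (fun W : Finset (Vtx m) => crossGraph W ∉ 𝒜), biasedWeight (1 / 8) W :=
          sum_le_sum_of_subset_of_nonneg hsub fun W _ _ => biasedWeight_nonneg h18 h18' W
      _ ≤ ∑ W ∈ univ.filter (fun W : Finset (Vtx m) => crossGraph W ∈ BadN), biasedWeight (1 / 8) W +
            ∑ W ∈ univ.filter (fun W : Finset (Vtx m) => crossGraph W ∉ 𝒜), biasedWeight (1 / 8) W :=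
          ApproxScheme.sum_union_le_of_nonneg (fun W => biasedWeight_nonneg h18 h18' W) _ _
      _ ≤ _ := by rw [hBadN, hnot𝒜]; exact add_le_add hcN le_rfl
  -- dichotomy on `∅ ∈ 𝒜`
  by_cases h0 : ∅ ∈ 𝒜
  · left
    have hall : ∀ U : Finset (Edge m), U ∈ 𝒜 := fun U => hok.isUpperSet (empty_subset U) h0
    rw [prW_eq_zero fun U h => h (hall U), add_zero] at hN
    exact hN
  · right
    have h := sum_perm_mem_le (m := m) hSF hc0 (by norm_num) (by norm_num) hε0 hε1 hok h0
    have : ∑ _σ ∈ univ.filter (fun σ : Equiv.Perm (Fin m) => permGraph σ ∈ 𝒜), (1 / m.factorial : ℝ)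
        ≤ posSmall c₀ ε m c := h
    linarith

end Summit.PneNP.PneNP.Theorems.NegLimitedGapPM
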